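import Literature.Computability.AlgebraicComplexity.InterfaceSlotSymmetry
import HarnessLib

/-!
# Rational parameter records and counting lemmas for matching the stages of the laser-method
recursion (Vassilevska Williams–Xu–Xu–Zhou 2024, §8) — proved

Topic `Literature/Computability/AlgebraicComplexity`.  The stages of the Procedure of Degeneration
(§8) are matched existentially (`TermMapMatching.exists_termMatching`): one needs, for every key
(parameter record of a term, its number of chunks), the number of terms with that key on both sides,
and these numbers must be checkable by the kernel at rational data.  This file provides

* `InterfaceTermQ c` — parameter records with RATIONAL split distributions, `toReal` into
  `InterfaceTerm c` (injective, `toReal_injective`), and its compatibility with the renamings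
  `swapYZ`, `swapXZ` of `InterfaceSlotSymmetry`;
* counting lemmas turning `Fintype.card` of subtypes of the index types used by the tree's parameter
  lists into sums the kernel evaluates: over `Fin (A + B)` (`card_subtype_fin_add`), over
  `Fin (s · C)` through `finProdFinEquiv` (`card_subtype_finProd`), and over `Fin S.card` through
  `S.equivFin` for a finset `S` (`card_subtype_equivFin`).

Everything is proved (folklore); the definitions are the record type and its maps.

## References

* V. Vassilevska Williams, Y. Xu, Z. Xu, R. Zhou, *New bounds for matrix multiplication: from alpha
  to omega*, SODA 2024, arXiv:2307.07970, Def. 4.1 and §8. [VassilevskaWilliamsXuXuZhou2024]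
-/

open scoped BigOperators
open Finset

namespace Literature.Computability.AlgebraicComplexity

/-! ## Rational parameter records -/

/-- **A parameter record with rational split distributions** `(i, j, k, γ_X, γ_Y, γ_Z)`. [cite: VassilevskaWilliamsXuXuZhou2024, Def. 4.1 (parameter list)] -/
structure InterfaceTermQ (c : ℕ) where
  /-- level-`ℓ` `X`-block index `i` -/
  i : ℕ
  /-- level-`ℓ` `Y`-block index `j` -/
  j : ℕ
  /-- level-`ℓ` `Z`-block index `k` -/
  k : ℕ
  /-- rational complete split distribution for the `X`-blocks -/
  γX : (Fin c → Fin 3) → ℚ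
  /-- rational complete split distribution for the `Y`-blocks -/
  γY : (Fin c → Fin 3) → ℚ
  /-- rational complete split distribution for the `Z`-blocks -/
  γZ : (Fin c → Fin 3) → ℚ
  deriving DecidableEq

namespace InterfaceTermQ

variable {c : ℕ}

/-- The real parameter record of a rational one. [folklore] -/
def toReal (T : InterfaceTermQ c) : InterfaceTerm c :=
  ⟨T.i, T.j, T.k, fun σ => (T.γX σ : ℝ), fun σ => (T.γY σ : ℝ), fun σ => (T.γZ σ : ℝ)⟩

/-- Components of `toReal`. [folklore] -/
@[simp] theorem toReal_i (T : InterfaceTermQ c) : T.toReal.i = T.i := rfl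
/-- Components of `toReal`. [folklore] -/
@[simp] theorem toReal_j (T : InterfaceTermQ c) : T.toReal.j = T.j := rfl
/-- Components of `toReal`. [folklore] -/
@[simp] theorem toReal_k (T : InterfaceTermQ c) : T.toReal.k = T.k := rfl
/-- Components of `toReal`. [folklore] -/
@[simp] theorem toReal_γX (T : InterfaceTermQ c) (σ : Fin c → Fin 3) : T.toReal.γX σ = T.γX σ := rfl
/-- Components of `toReal`. [folklore] -/
@[simp] theorem toReal_γY (T : InterfaceTermQ c) (σ : Fin c → Fin 3) : T.toReal.γY σ = T.γY σ := rfl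
/-- Components of `toReal`. [folklore] -/
@[simp] theorem toReal_γZ (T : InterfaceTermQ c) (σ : Fin c → Fin 3) : T.toReal.γZ σ = T.γZ σ := rfl

/-- **`toReal` is injective** (`ℚ → ℝ` is). [folklore] -/
theorem toReal_injective : Function.Injective (toReal (c := c)) := by
  rintro ⟨i, j, k, x, y, z⟩ ⟨i', j', k', x', y', z'⟩ h
  simp only [toReal, InterfaceTerm.mk.injEq] at h
  obtain ⟨hi, hj, hk, hx, hy, hz⟩ := h
  have ex : x = x' := funext fun σ => by exact_mod_cast congrFun hx σ
  have ey : y = y' := funext fun σ => by exact_mod_cast congrFun hy σ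
  have ez : z = z' := funext fun σ => by exact_mod_cast congrFun hz σ
  subst hi; subst hj; subst hk; subst ex; subst ey; subst ez
  rfl

/-- `toReal T = toReal T' ↔ T = T'`. [folklore] -/
theorem toReal_inj {T T' : InterfaceTermQ c} : T.toReal = T'.toReal ↔ T = T' := toReal_injective.eq_iff

/-- Renaming `Y ↔ Z` of a rational record. [cite: VassilevskaWilliamsXuXuZhou2024, §5.1] -/
def swapYZ (T : InterfaceTermQ c) : InterfaceTermQ c := ⟨T.i, T.k, T.j, T.γX, T.γZ, T.γY⟩

/-- Renaming `X ↔ Z` of a rational record. [cite: VassilevskaWilliamsXuXuZhou2024, §5.1] -/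
def swapXZ (T : InterfaceTermQ c) : InterfaceTermQ c := ⟨T.k, T.j, T.i, T.γZ, T.γY, T.γX⟩

/-- `toReal` commutes with `swapYZ`. [folklore] -/
@[simp] theorem toReal_swapYZ (T : InterfaceTermQ c) : T.swapYZ.toReal = T.toReal.swapYZ := rfl

/-- `toReal` commutes with `swapXZ`. [folklore] -/
@[simp] theorem toReal_swapXZ (T : InterfaceTermQ c) : T.swapXZ.toReal = T.toReal.swapXZ := rfl

end InterfaceTermQ

/-! ## Counting lemmas over the index types of the parameter lists -/

section Counting

/-- The size of a decidable subtype of a finite type as a sum of indicators. [folklore] -/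
theorem card_subtype_eq_sum_ite {α : Type*} [Fintype α] (Q : α → Prop) [DecidablePred Q] :
    Fintype.card {a // Q a} = ∑ a, if Q a then 1 else 0 := by
  rw [Fintype.card_subtype, Finset.card_filter]

/-- **Subtypes of `Fin (A + B)`**: split along `Fin.castAdd` / `Fin.natAdd`. [folklore] -/
theorem card_subtype_fin_add {A B : ℕ} (Q : Fin (A + B) → Prop) [DecidablePred Q] :
    Fintype.card {t // Q t} = Fintype.card {a : Fin A // Q (Fin.castAdd B a)} + Fintype.card {b : Fin B // Q (Fin.natAdd A b)} := by
  simp only [card_subtype_eq_sum_ite]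
  exact Fin.sum_univ_add _

/-- **Subtypes of `Fin (A + B + C)`**: split into the three summands. [folklore] -/
theorem card_subtype_fin_add₃ {A B C : ℕ} (Q : Fin (A + B + C) → Prop) [DecidablePred Q] :
    Fintype.card {t // Q t} =
      Fintype.card {a : Fin A // Q (Fin.castAdd C (Fin.castAdd B a))} +
        Fintype.card {b : Fin B // Q (Fin.castAdd C (Fin.natAdd A b))} + Fintype.card {d : Fin C // Q (Fin.natAdd (A + B) d)} := by
  rw [card_subtype_fin_add Q, card_subtype_fin_add (fun x : Fin (A + B) => Q (Fin.castAdd C x))]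

/-- **Subtypes of `Fin (s · C)`**: through `finProdFinEquiv`, a double sum of indicators. [folklore] -/
theorem card_subtype_finProd {s C : ℕ} (Q : Fin (s * C) → Prop) [DecidablePred Q] :
    Fintype.card {idx // Q idx} = ∑ t : Fin s, ∑ e : Fin C, if Q (finProdFinEquiv (t, e)) then 1 else 0 := by
  rw [card_subtype_eq_sum_ite, ← Equiv.sum_comp finProdFinEquiv, Fintype.sum_prod_type]

/-- **Subtypes of `Fin S.card`** for a finset `S`, through `S.equivFin`: a filter of `S`. [folklore] -/
theorem card_subtype_equivFin {α : Type*} [DecidableEq α] (S : Finset α) (Q : α → Prop) [DecidablePred Q] :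
    Fintype.card {e : Fin S.card // Q (S.equivFin.symm e).1} = (S.filter Q).card := by
  rw [Fintype.card_subtype]
  have h : (univ.filter fun e : Fin S.card => Q (S.equivFin.symm e).1) =
      ((S.attach.filter fun x => Q x.1).map S.equivFin.toEmbedding) := by
    ext e
    simp only [mem_filter, mem_univ, true_and, mem_map_equiv, mem_attach]
  rw [h, card_map, Finset.filter_attach', card_map, card_attach]
  congr 1
  ext x
  simp

/-- Sums of indicators over `Fin S.card` through `S.equivFin`. [folklore] -/
theorem sum_ite_equivFin {α : Type*} [DecidableEq α] (S : Finset α) (Q : α → Prop) [DecidablePred Q] :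
    (∑ e : Fin S.card, if Q (S.equivFin.symm e).1 then 1 else 0) = (S.filter Q).card := by
  rw [← card_subtype_eq_sum_ite (fun e : Fin S.card => Q (S.equivFin.symm e).1), card_subtype_equivFin]

end Counting

end Literature.Computability.AlgebraicComplexity
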